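import Summits.HubbardSuperconductivity.HubbardSuperconductivity.Theorems.KLProgrammeKLRegimeScaleZeroCovarianceTorusPeriodisation
import Summits.HubbardSuperconductivity.HubbardSuperconductivity.Theorems.KLProgrammeKLRegimeScaleZeroCovarianceOffSiteExplicit
import Summits.HubbardSuperconductivity.HubbardSuperconductivity.Theorems.KLProgrammeKLRegimeFlowReadScaleZeroSunsetFarRowsL2
import Literature.Analysis.FunctionSpaces.TorusFourierCalculus

/-!
# Route `KLProgramme`, crux K3 — engine-flow child (stmt-HubbardSuperconductivity-20437), stub (C) at `n = 0`, located item #22a «(C)-SCALE0-PT2»,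
# the FAR-SITE supplier, LOW shell («(2e)-LOW-SHELL-PLANCHEREL», route of record (R221)): THE FAR WEIGHTED ℓ² AT FINITE `L` FROM THE LATTICE FAR SUM
# OF THE INFINITE-VOLUME KERNEL — images identity + Minkowski + EXACT continuum Parseval (no finite-difference Plancherel)

Cell gate-hubbard-kl, seat p1 g22 (supplier; the cert predicate, the kit and the closer are the k3c5 lineage's).  The TWO-SHELLS interface
`…SunsetFarRowsL2.farRows_le_of_l2Far` wants, per Matsubara frequency `ω`, a bound `Φ` on
`Σ_{u ∈ 𝕋_L, u ≠ 0, ũ ∉ disk} w_k(ũ)·‖TFI_ω(u)‖²` (`ũ` = centred representative, `w_k(ũ) = √(ũ₀²+ũ₁²)ᵏ`, `TFI_ω = torusFourierInv` of the sampled spatial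
symbol `g_ω(y) = Ψ(ω, e₀(2πy))`).  On the low shell (`|ω| < ω₁`, χ₂ active) the strip door is useless and `Φ` comes from a kit-certified COMPLEMENT.  The
finite-difference weighted Plancherel door `TorusFourierMomentsFromDifferences.sum_mixedMonomial_mul_norm_sq_torusFourierInv_le` is NOT usable for that: its
`(L/4)^{2k}` over-counts the `k = 2` total by up to `(π/2)²` and the complement lives on cancellation.  This file goes through the IMAGES IDENTITY instead:
* §1 `norm_torusFourierInv_smoothSample_le_coeff_add_images` — `‖TFI(z̄)‖ ≤ ‖a(z)‖ + T(z)`, `a(z) = 𝓕(g♭)(−z)` the infinite-volume kernel,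
  `T(z) = Σ_{n ≠ 0}‖a(z + Ln)‖` the images tail (`torusFourierInv_smoothSample_eq_tsum`, any smooth `ℤ²`-periodic `g`);
  `images_tail_le_of_decay` — `T(z) ≤ C·(4/L)ᴷ·S_K` at every CENTRED `z` from `‖𝓕(g♭)(k)‖ ≤ C(1+‖k‖∞)^{−K}` (`k ≠ 0`), `S_K = Σ_n (1+‖n‖∞)^{−K}`;
* §2 `sum_weight_mul_sq_le_sqrt_add_sqrt_sq` — Minkowski in a weighted finite ℓ²: `Σ W·(x+y)² ≤ (√(Σ W x²) + √(Σ W y²))²`;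
  `sum_centred_le_tsum` — a nonnegative summable lattice function summed over the centred representatives of `𝕋_L` is `≤` its lattice sum;
* §3 EXACT CONTINUUM PARSEVAL for the kernel (`Torus.hasSum_sq_mFourierCoeff_of_continuous`, `Torus.mFourierCoeff_partialDeriv`; regularity asked: `g` smooth
  and `ℤ²`-periodic on `ℝ²`, which `uvSpatialSymbol_contDiff`/`_isLatticePeriodic` supply for every `ω ≠ 0`):
  `hasSum_normSq_kernel` — `Σ_z ‖a(z)‖² = ∫_{[0,1)²} ‖g‖²`; `hasSum_sq_mul_normSq_kernel` — `Σ_z z_j²‖a(z)‖² = (2π)⁻²∫_{[0,1)²} ‖∂_j g‖²`;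
  `tsum_far_eq_total_sub_near` — the complement of a finite NEAR set: `Σ_{z ∉ B} w·‖a‖² = total − Σ_{z ∈ B} w·‖a‖²`;
* §4 **`sum_weight_normSq_torusFourierInv_le`** — THE L-FREE MAJORANT (generic): for `W ≥ 0` on `ℤ²`,
  `Σ_u W(ũ)‖TFI(u)‖² ≤ (√(Σ_z W(z)‖a(z)‖²) + √(Σ_u W(ũ))·τ)²`, `τ` any bound of the images tail on centred sites;
* companion file `…ScaleZeroCovarianceFarL2ImagesBare`: `k = 1` by Cauchy–Schwarz of the two far sums (`far₁ ≤ √(far₀·far₂)`, so a certificate needs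
  `D₀, D₂` only) and the bare-frame scale-`0` instance `l2Far_low_of_farLattice` in EXACTLY the `hΦ` shape of `farRows_le_of_l2Far`, images constant
  hypothesis-free from the table-free bare jets.

Proofs only; no definitions; nothing here asserts (C), any stub of 20437, K3 or superconductivity; the far lattice sum bound `D` is a HYPOTHESIS (kit-certified
envelope, never discharged in Lean).  References: BGM 2006 §2.2 footnote 1, §3 (3.2) [cite: BenfattoGiulianiMastropietro2006]; Glimm–Jaffe 1987 Prop. 7.3.1
[cite: GlimmJaffeQP1987]; Grafakos 2014 Prop. 3.2.6 (8), Prop. 3.2.7 (3) [cite: Grafakos2014].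
-/

noncomputable section

namespace Summit.HubbardSuperconductivity.HubbardSuperconductivity.Theorems.KLRegimeSplit

set_option linter.dupNamespace false -- summit = problem name (single-conjunct summit), D-0017

open Literature.MathematicalPhysics.QuantumLattice Literature.Probability.LatticeModels Literature.Analysis.FunctionSpaces
open Literature.Analysis.Fourier
open Summit.HubbardSuperconductivity.HubbardSuperconductivity.Theorems.DispersionFlow
open MeasureTheory Finset Complex UnitAddTorus Real
open scoped Nat

variable {L : ℕ} [NeZero L]

/-! ## §1 The images split and the images tail -/

section Images

variable {g : EuclideanSpace ℝ (Fin 2) → ℂ} (hper : Torus.IsLatticePeriodic g) (hs : ContDiff ℝ (⊤ : ℕ∞) g)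
include hs

omit [NeZero L] in
/-- The kernel `z ↦ 𝓕(g♭)(−z)` is absolutely summable on `ℤ²` (smooth periodic `g`). -/
theorem summable_norm_kernel : Summable fun z : Site 2 => ‖mFourierCoeff (Torus.descend g hper) (-z)‖ :=
  ((summable_norm_mFourierCoeff_descend hper hs).comp_injective neg_injective :)

/-- **The images split**: for a smooth `ℤ²`-periodic `g` on `ℝ²`, every `L ≥ 1` and every `z ∈ ℤ²`,
`‖L⁻²Σ_k χ_k(z̄) g(k/L)‖ ≤ ‖𝓕(g♭)(−z)‖ + Σ_{n ≠ 0} ‖𝓕(g♭)(−(z + Ln))‖` (the `n = 0` image is the infinite-volume kernel). -/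
theorem norm_torusFourierInv_smoothSample_le_coeff_add_images (z : Site 2) :
    ‖torusFourierInv (fun k : TorusSite 2 L => g (WithLp.toLp 2 fun i => ((k i).val : ℝ) / L)) (Torus.proj L z)‖ ≤
      ‖mFourierCoeff (Torus.descend g hper) (-z)‖ +
        ∑' n : Site 2, (if n = 0 then 0 else ‖mFourierCoeff (Torus.descend g hper) (-(z + (L : ℤ) • n))‖) := by
  classical
  rw [torusFourierInv_smoothSample_eq_tsum hper hs z]
  have hsum : Summable fun n : Site 2 => ‖mFourierCoeff (Torus.descend g hper) (-(z + (L : ℤ) • n))‖ :=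
    summable_norm_translate_zsmul (L := L) (summable_norm_kernel hper hs) z
  refine (norm_tsum_le_tsum_norm hsum).trans (le_of_eq ?_)
  rw [hsum.tsum_eq_add_tsum_ite 0]
  simp only [smul_zero, add_zero]

omit hs in
omit [NeZero L] in
/-- **The images tail at a centred site**: if `‖𝓕(g♭)(k)‖ ≤ C·(1+‖k‖∞)^{−K}` for all `k ≠ 0` (`C ≥ 0`, `K ≥ 4`), then for `L ≥ 1` and `2‖z‖∞ ≤ L`,
`Σ_{n ≠ 0} ‖𝓕(g♭)(−(z + Ln))‖ ≤ C·(4/L)ᴷ·Σ_n (1+‖n‖∞)^{−K}` (the nonzero images lie at sup-distance `≥ L‖n‖∞/2`). -/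
theorem images_tail_le_of_decay {C : ℝ} (hC : 0 ≤ C) {K : ℕ} (hK : 2 * 2 ≤ K)
    (ha : ∀ k : Site 2, k ≠ 0 → ‖mFourierCoeff (Torus.descend g hper) k‖ ≤ C * ((1 + ‖k‖) ^ K)⁻¹)
    (hL : 1 ≤ L) {z : Site 2} (hz : 2 * ‖z‖ ≤ L) :
    ∑' n : Site 2, (if n = 0 then 0 else ‖mFourierCoeff (Torus.descend g hper) (-(z + (L : ℤ) • n))‖) ≤
      C * (4 / (L : ℝ)) ^ K * ∑' n : Site 2, ((1 + ‖n‖) ^ K)⁻¹ := by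
  classical
  have hS := summable_inv_one_add_norm_pow (d := 2) hK
  have hLr : (1 : ℝ) ≤ L := by exact_mod_cast hL
  have hL0 : (0 : ℝ) < L := by linarith
  -- termwise majorant
  have hle : ∀ n : Site 2, (if n = 0 then 0 else ‖mFourierCoeff (Torus.descend g hper) (-(z + (L : ℤ) • n))‖) ≤
      C * (4 / (L : ℝ)) ^ K * ((1 + ‖n‖) ^ K)⁻¹ := by
    intro n
    by_cases hn : n = 0
    · rw [if_pos hn]; positivity
    rw [if_neg hn]
    -- `‖n‖ ≥ 1`, `‖z + Ln‖ ≥ L‖n‖ − ‖z‖ ≥ L‖n‖/2`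
    have hn1 : (1 : ℝ) ≤ ‖n‖ := by
      obtain ⟨i, hi⟩ : ∃ i, n i ≠ 0 := by
        by_contra h
        push Not at h
        exact hn (funext h)
      calc (1 : ℝ) ≤ ‖n i‖ := by rw [Int.norm_eq_abs]; exact_mod_cast Int.one_le_abs hi
        _ ≤ ‖n‖ := norm_le_pi_norm n i
    have himg : (L : ℝ) * ‖n‖ - ‖z‖ ≤ ‖z + (L : ℤ) • n‖ := sub_le_norm_translate L z n
    have hfar : (L : ℝ) * ‖n‖ / 2 ≤ ‖z + (L : ℤ) • n‖ := by nlinarith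
    have hne : z + (L : ℤ) • n ≠ 0 := by
      intro h0
      rw [h0, norm_zero] at hfar
      nlinarith
    have hne' : -(z + (L : ℤ) • n) ≠ 0 := neg_ne_zero.2 hne
    refine (ha _ hne').trans ?_
    rw [norm_neg, mul_assoc]
    refine mul_le_mul_of_nonneg_left ?_ hC
    -- `(1+‖z+Ln‖)^{-K} ≤ (4/L)^K (1+‖n‖)^{-K}` from `(1+‖n‖)·L/4 ≤ L‖n‖/2 ≤ 1 + ‖z+Ln‖`
    have hkey : (1 + ‖n‖) * ((L : ℝ) / 4) ≤ 1 + ‖z + (L : ℤ) • n‖ := by nlinarith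
    have hq : 0 < (1 + ‖n‖) * ((L : ℝ) / 4) := by positivity
    calc ((1 + ‖z + (L : ℤ) • n‖) ^ K)⁻¹ ≤ (((1 + ‖n‖) * ((L : ℝ) / 4)) ^ K)⁻¹ :=
          inv_anti₀ (pow_pos hq K) (pow_le_pow_left₀ hq.le hkey K)
      _ = (4 / (L : ℝ)) ^ K * ((1 + ‖n‖) ^ K)⁻¹ := by
          rw [mul_pow, mul_inv, mul_comm, ← inv_pow, inv_div]
  have hmaj : Summable fun n : Site 2 => C * (4 / (L : ℝ)) ^ K * ((1 + ‖n‖) ^ K)⁻¹ := hS.mul_left _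
  have h0 : ∀ n : Site 2, 0 ≤ (if n = 0 then 0 else ‖mFourierCoeff (Torus.descend g hper) (-(z + (L : ℤ) • n))‖) :=
    fun n => by split_ifs <;> positivity
  calc _ ≤ ∑' n : Site 2, C * (4 / (L : ℝ)) ^ K * ((1 + ‖n‖) ^ K)⁻¹ :=
        (Summable.of_nonneg_of_le h0 hle hmaj).tsum_le_tsum hle hmaj
    _ = C * (4 / (L : ℝ)) ^ K * ∑' n : Site 2, ((1 + ‖n‖) ^ K)⁻¹ := tsum_mul_left

end Images

/-! ## §2 Minkowski in a weighted finite ℓ² and the injection of the centred representatives -/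

omit [NeZero L] in
/-- **Minkowski, weighted finite form**: for `W ≥ 0` on a finset and `0 ≤ F ≤ x + y` termwise,
`Σ W·F² ≤ (√(Σ W x²) + √(Σ W y²))²` (Cauchy–Schwarz on the cross term). -/
theorem sum_weight_mul_sq_le_sqrt_add_sqrt_sq {ι : Type*} (s : Finset ι) {W x y F : ι → ℝ} (hW : ∀ i ∈ s, 0 ≤ W i)
    (hF0 : ∀ i ∈ s, 0 ≤ F i) (hF : ∀ i ∈ s, F i ≤ x i + y i) :
    ∑ i ∈ s, W i * F i ^ 2 ≤ (Real.sqrt (∑ i ∈ s, W i * x i ^ 2) + Real.sqrt (∑ i ∈ s, W i * y i ^ 2)) ^ 2 := by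
  set A := ∑ i ∈ s, W i * x i ^ 2 with hA
  set B := ∑ i ∈ s, W i * y i ^ 2 with hB
  have hA0 : 0 ≤ A := Finset.sum_nonneg fun i hi => mul_nonneg (hW i hi) (sq_nonneg _)
  have hB0 : 0 ≤ B := Finset.sum_nonneg fun i hi => mul_nonneg (hW i hi) (sq_nonneg _)
  -- termwise `W F² ≤ W (x+y)²`
  have h1 : ∑ i ∈ s, W i * F i ^ 2 ≤ ∑ i ∈ s, W i * (x i + y i) ^ 2 :=
    Finset.sum_le_sum fun i hi => mul_le_mul_of_nonneg_left (pow_le_pow_left₀ (hF0 i hi) (hF i hi) 2) (hW i hi)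
  -- the cross term by Cauchy–Schwarz: `(Σ W x y)² ≤ A·B`
  have hcs : (∑ i ∈ s, W i * x i * y i) ^ 2 ≤ A * B :=
    Finset.sum_sq_le_sum_mul_sum_of_sq_le_mul s (fun i hi => mul_nonneg (hW i hi) (sq_nonneg _))
      (fun i hi => mul_nonneg (hW i hi) (sq_nonneg _)) (fun i hi => le_of_eq (by ring))
  have hcross : ∑ i ∈ s, W i * x i * y i ≤ Real.sqrt A * Real.sqrt B := by
    rw [← Real.sqrt_mul hA0]
    exact Real.le_sqrt_of_sq_le hcs
  have hexp : ∑ i ∈ s, W i * (x i + y i) ^ 2 = A + 2 * ∑ i ∈ s, W i * x i * y i + B := by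
    simp only [hA, hB, Finset.mul_sum, ← Finset.sum_add_distrib]
    exact Finset.sum_congr rfl fun i _ => by ring
  calc ∑ i ∈ s, W i * F i ^ 2 ≤ A + 2 * ∑ i ∈ s, W i * x i * y i + B := h1.trans (le_of_eq hexp)
    _ ≤ A + 2 * (Real.sqrt A * Real.sqrt B) + B := by linarith
    _ = (Real.sqrt A + Real.sqrt B) ^ 2 := by
        rw [add_sq, Real.sq_sqrt hA0, Real.sq_sqrt hB0]; ring

/-- **The centred representatives inject into `ℤ²`**: for a nonnegative summable `f` on `ℤ²`,
`Σ_{u ∈ 𝕋_L} f(ũ) ≤ Σ_{z ∈ ℤ²} f(z)`, `ũ_j = valMinAbs(u_j)`. -/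
theorem sum_centred_le_tsum {f : Site 2 → ℝ} (hf0 : ∀ z, 0 ≤ f z) (hf : Summable f) :
    ∑ u : TorusSite 2 L, f (fun j => (u j).valMinAbs) ≤ ∑' z : Site 2, f z := by
  classical
  set zc : TorusSite 2 L → Site 2 := fun u => fun j => (u j).valMinAbs with hzc
  have hproj : ∀ u : TorusSite 2 L, Torus.proj L (zc u) = u := fun u => (two_mul_norm_valMinAbs_le u).1
  have hinj : Function.Injective zc := fun u v huv => by
    have h := congrArg (Torus.proj L) huv
    rwa [hproj u, hproj v] at h
  calc ∑ u : TorusSite 2 L, f (zc u) = ∑ z ∈ (Finset.univ : Finset (TorusSite 2 L)).image zc, f z := by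
        rw [Finset.sum_image fun u _ v _ h => hinj h]
    _ ≤ ∑' z : Site 2, f z := hf.sum_le_tsum _ fun z _ => hf0 z

/-! ## §3 Exact continuum Parseval for the infinite-volume kernel -/

section Parseval

variable {g : EuclideanSpace ℝ (Fin 2) → ℂ} (hper : Torus.IsLatticePeriodic g) (hs : ContDiff ℝ (⊤ : ℕ∞) g)
include hs

omit [NeZero L] in
/-- **Parseval, `k = 0`**: `Σ_{z ∈ ℤ²} ‖𝓕(g♭)(−z)‖² = ∫_{[0,1)²} ‖g‖²` (smooth periodic `g`; the torus integral of the descent, rewritten on the period cell). -/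
theorem hasSum_normSq_kernel :
    HasSum (fun z : Site 2 => ‖mFourierCoeff (Torus.descend g hper) (-z)‖ ^ 2) (∫ y in Torus.unitCube (Fin 2), ‖g y‖ ^ 2) := by
  have hc : Continuous (Torus.descend g hper) := continuous_descend g hper hs.continuous
  have hP := Torus.hasSum_sq_mFourierCoeff_of_continuous hc
  have hint : (∫ x, ‖Torus.descend g hper x‖ ^ 2) = ∫ y in Torus.unitCube (Fin 2), ‖g y‖ ^ 2 := by
    rw [Torus.integral_eq_integral_lift_holds]
    refine setIntegral_congr_fun Torus.measurableSet_unitCube fun y _ => ?_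
    have h := congrFun (Torus.lift_descend_holds g hper) y
    simp only [Torus.lift_apply] at h ⊢
    rw [h]
  rw [← hint]
  exact (Equiv.neg (Site 2)).hasSum_iff.2 hP

omit [NeZero L] in
/-- **Parseval, one derivative**: `Σ_{z ∈ ℤ²} z_j²·‖𝓕(g♭)(−z)‖² = (2π)⁻²·∫_{[0,1)²} ‖∂_j g‖²`, `∂_j g(y) = Dg(y)[e_j]`
(`Torus.mFourierCoeff_partialDeriv`: `𝓕(∂_j g♭)(n) = 2πi n_j·𝓕(g♭)(n)`, then Parseval for the continuous `∂_j g♭`). -/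
theorem hasSum_sq_mul_normSq_kernel (j : Fin 2) :
    HasSum (fun z : Site 2 => ((z j : ℤ) : ℝ) ^ 2 * ‖mFourierCoeff (Torus.descend g hper) (-z)‖ ^ 2)
      ((2 * π) ^ (-(2 : ℤ)) * ∫ y in Torus.unitCube (Fin 2), ‖fderiv ℝ g y (EuclideanSpace.single j (1 : ℝ))‖ ^ 2) := by
  classical
  have hsm : Torus.IsSmooth (Torus.descend g hper) := isSmooth_descend g hper hs
  have hdc : Continuous (Torus.partialDeriv j (Torus.descend g hper)) := (hsm.partialDeriv j).continuous
  have hP := Torus.hasSum_sq_mFourierCoeff_of_continuous hdc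
  -- the coefficients of the derivative
  have hcoef : ∀ n : Site 2, ‖mFourierCoeff (Torus.partialDeriv j (Torus.descend g hper)) n‖ ^ 2 =
      (2 * π) ^ 2 * (((n j : ℤ) : ℝ) ^ 2 * ‖mFourierCoeff (Torus.descend g hper) n‖ ^ 2) := by
    intro n
    rw [Torus.mFourierCoeff_partialDeriv hsm j n, norm_smul]
    have : ‖(2 * (π : ℂ) * Complex.I * ((n j : ℤ) : ℂ))‖ = 2 * π * |((n j : ℤ) : ℝ)| := by
      rw [norm_mul, norm_mul, norm_mul, Complex.norm_I, mul_one, Complex.norm_two, Complex.norm_real, Real.norm_eq_abs,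
        abs_of_pos Real.pi_pos, ← Int.cast_abs, Complex.norm_intCast, Int.cast_abs]
    rw [this]
    rw [mul_pow, mul_pow, sq_abs]
    ring
  -- the integral on the period cell
  have hint : (∫ x, ‖Torus.partialDeriv j (Torus.descend g hper) x‖ ^ 2) =
      ∫ y in Torus.unitCube (Fin 2), ‖fderiv ℝ g y (EuclideanSpace.single j (1 : ℝ))‖ ^ 2 := by
    rw [Torus.integral_eq_integral_lift_holds]
    refine setIntegral_congr_fun Torus.measurableSet_unitCube fun y _ => ?_
    have h := congrFun (lift_partialDeriv_iterate_descend hs hper j 1) y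
    simp only [Function.iterate_one] at h
    simp only [Torus.lift_apply] at h ⊢
    rw [h]
    rfl
  simp_rw [hcoef] at hP
  rw [hint] at hP
  have hπ : (2 * π : ℝ) ^ 2 ≠ 0 := by positivity
  have h2 := hP.mul_left (((2 * π : ℝ) ^ 2)⁻¹)
  simp_rw [← mul_assoc, inv_mul_cancel₀ hπ, one_mul] at h2
  rw [zpow_neg, zpow_ofNat]
  have hfun : (fun z : Site 2 => ((z j : ℤ) : ℝ) ^ 2 * ‖mFourierCoeff (Torus.descend g hper) (-z)‖ ^ 2) =
      (fun i : Site 2 => ((i j : ℤ) : ℝ) ^ 2 * ‖mFourierCoeff (Torus.descend g hper) i‖ ^ 2) ∘ (Equiv.neg (Site 2)) := by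
    funext z
    simp only [Function.comp_apply, Equiv.neg_apply, Pi.neg_apply, Int.cast_neg, neg_sq]
  rw [hfun]
  exact (Equiv.neg (Site 2)).hasSum_iff.2 h2

omit [NeZero L] in
/-- **Parseval, `k = 2`**: `Σ_{z ∈ ℤ²} (z₀² + z₁²)·‖𝓕(g♭)(−z)‖² = (2π)⁻²·(∫_{[0,1)²} ‖∂₀ g‖² + ∫_{[0,1)²} ‖∂₁ g‖²)`. -/
theorem hasSum_sqNorm_mul_normSq_kernel :
    HasSum (fun z : Site 2 => ((((z 0 : ℤ) : ℝ)) ^ 2 + (((z 1 : ℤ) : ℝ)) ^ 2) * ‖mFourierCoeff (Torus.descend g hper) (-z)‖ ^ 2)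
      ((2 * π) ^ (-(2 : ℤ)) * ((∫ y in Torus.unitCube (Fin 2), ‖fderiv ℝ g y (EuclideanSpace.single 0 (1 : ℝ))‖ ^ 2) +
        ∫ y in Torus.unitCube (Fin 2), ‖fderiv ℝ g y (EuclideanSpace.single 1 (1 : ℝ))‖ ^ 2)) := by
  have h := (hasSum_sq_mul_normSq_kernel hper hs 0).add (hasSum_sq_mul_normSq_kernel hper hs 1)
  rw [← mul_add] at h
  convert h using 1
  funext z
  ring

omit [NeZero L] hs in
/-- **The complement of a finite near set**: for a summable nonnegative-weighted family, `Σ_z [z ∉ B]·w(z)‖a(z)‖² = Σ_z w‖a‖² − Σ_{z ∈ B} w‖a‖²`. -/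
theorem tsum_far_eq_total_sub_near {w : Site 2 → ℝ} (B : Finset (Site 2))
    (hsum : Summable fun z : Site 2 => w z * ‖mFourierCoeff (Torus.descend g hper) (-z)‖ ^ 2) :
    ∑' z : Site 2, (if z ∈ B then 0 else w z * ‖mFourierCoeff (Torus.descend g hper) (-z)‖ ^ 2) =
      (∑' z : Site 2, w z * ‖mFourierCoeff (Torus.descend g hper) (-z)‖ ^ 2) -
        ∑ z ∈ B, w z * ‖mFourierCoeff (Torus.descend g hper) (-z)‖ ^ 2 := by
  classical
  set f : Site 2 → ℝ := fun z => w z * ‖mFourierCoeff (Torus.descend g hper) (-z)‖ ^ 2 with hf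
  have h1 := hsum.sum_add_tsum_compl (s := B)
  have h2 : ∑' z : ((↑B : Set (Site 2))ᶜ : Set (Site 2)), f z = ∑' z : Site 2, (if z ∈ B then 0 else f z) := by
    rw [_root_.tsum_subtype]
    refine tsum_congr fun z => ?_
    rw [Set.indicator_apply]
    by_cases hz : z ∈ B
    · rw [if_pos hz, if_neg (by simpa using hz)]
    · rw [if_neg hz, if_pos (by simpa using hz)]
  rw [← h1, h2]
  ring

end Parseval

/-! ## §4 The L-free majorant, generic form -/

section Majorant

variable {g : EuclideanSpace ℝ (Fin 2) → ℂ} (hper : Torus.IsLatticePeriodic g) (hs : ContDiff ℝ (⊤ : ℕ∞) g)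
include hs

/-- **THE L-FREE MAJORANT OF A WEIGHTED ℓ² OF THE FINITE-TORUS FOURIER INVERSE** (smooth `ℤ²`-periodic `g` on `ℝ²`, `L ≥ 1`): for a lattice weight
`W ≥ 0` with `W·‖a‖²` summable (`a(z) = 𝓕(g♭)(−z)`), a bound `D` of the weighted lattice sum `Σ_z W(z)‖a(z)‖²` and a bound `τ ≥ 0` of the images tail
`Σ_{n ≠ 0}‖a(z + Ln)‖` on centred sites,
`Σ_{u ∈ 𝕋_L} W(ũ)·‖L⁻²Σ_k χ_k(u) g(k/L)‖² ≤ (√D + √(Σ_u W(ũ))·τ)²` (Minkowski over the images identity). -/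
theorem sum_weight_normSq_torusFourierInv_le (W : Site 2 → ℝ) (hW : ∀ z, 0 ≤ W z)
    (hWs : Summable fun z : Site 2 => W z * ‖mFourierCoeff (Torus.descend g hper) (-z)‖ ^ 2)
    {D : ℝ} (hD : ∑' z : Site 2, W z * ‖mFourierCoeff (Torus.descend g hper) (-z)‖ ^ 2 ≤ D)
    {τ : ℝ} (hτ0 : 0 ≤ τ)
    (hτ : ∀ z : Site 2, 2 * ‖z‖ ≤ L →
      ∑' n : Site 2, (if n = 0 then 0 else ‖mFourierCoeff (Torus.descend g hper) (-(z + (L : ℤ) • n))‖) ≤ τ) :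
    ∑ u : TorusSite 2 L, W (fun j => (u j).valMinAbs) *
        ‖torusFourierInv (fun k : TorusSite 2 L => g (WithLp.toLp 2 fun i => ((k i).val : ℝ) / L)) u‖ ^ 2 ≤
      (Real.sqrt D + Real.sqrt (∑ u : TorusSite 2 L, W (fun j => (u j).valMinAbs)) * τ) ^ 2 := by
  classical
  set zc : TorusSite 2 L → Site 2 := fun u => fun j => (u j).valMinAbs with hzc
  have hproj : ∀ u : TorusSite 2 L, Torus.proj L (zc u) = u := fun u => (two_mul_norm_valMinAbs_le u).1
  have hzcL : ∀ u : TorusSite 2 L, 2 * ‖zc u‖ ≤ L := fun u => (two_mul_norm_valMinAbs_le u).2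
  set a : Site 2 → ℝ := fun z => ‖mFourierCoeff (Torus.descend g hper) (-z)‖ with ha
  set T : Site 2 → ℝ := fun z => ∑' n : Site 2, (if n = 0 then 0 else ‖mFourierCoeff (Torus.descend g hper) (-(z + (L : ℤ) • n))‖)
    with hT
  have hT0 : ∀ z, 0 ≤ T z := fun z => tsum_nonneg fun n => by split_ifs <;> positivity
  -- §1: `‖TFI(u)‖ ≤ a(ũ) + T(ũ)`
  have hsplit : ∀ u : TorusSite 2 L,
      ‖torusFourierInv (fun k : TorusSite 2 L => g (WithLp.toLp 2 fun i => ((k i).val : ℝ) / L)) u‖ ≤ a (zc u) + T (zc u) := by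
    intro u
    have h := norm_torusFourierInv_smoothSample_le_coeff_add_images (L := L) hper hs (zc u)
    rwa [hproj u] at h
  -- §2: Minkowski
  have hM := sum_weight_mul_sq_le_sqrt_add_sqrt_sq (Finset.univ : Finset (TorusSite 2 L)) (W := fun u => W (zc u))
    (x := fun u => a (zc u)) (y := fun u => T (zc u))
    (F := fun u => ‖torusFourierInv (fun k : TorusSite 2 L => g (WithLp.toLp 2 fun i => ((k i).val : ℝ) / L)) u‖)
    (fun u _ => hW _) (fun u _ => norm_nonneg _) (fun u _ => hsplit u)
  refine hM.trans ?_
  -- the two square roots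
  have hA : Real.sqrt (∑ u, W (zc u) * a (zc u) ^ 2) ≤ Real.sqrt D := by
    refine Real.sqrt_le_sqrt ?_
    refine le_trans ?_ hD
    exact sum_centred_le_tsum (f := fun z => W z * a z ^ 2) (fun z => mul_nonneg (hW z) (sq_nonneg _)) hWs
  have hB : Real.sqrt (∑ u, W (zc u) * T (zc u) ^ 2) ≤ Real.sqrt (∑ u, W (zc u)) * τ := by
    rw [← Real.sqrt_sq hτ0, ← Real.sqrt_mul (Finset.sum_nonneg fun u _ => hW _)]
    refine Real.sqrt_le_sqrt ?_
    rw [Finset.sum_mul]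
    refine Finset.sum_le_sum fun u _ => mul_le_mul_of_nonneg_left ?_ (hW _)
    exact pow_le_pow_left₀ (hT0 _) (hτ _ (hzcL u)) 2
  have h0 : 0 ≤ Real.sqrt (∑ u, W (zc u) * a (zc u) ^ 2) + Real.sqrt (∑ u, W (zc u) * T (zc u) ^ 2) := by positivity
  exact pow_le_pow_left₀ h0 (add_le_add hA hB) 2

end Majorant

end Summit.HubbardSuperconductivity.HubbardSuperconductivity.Theorems.KLRegimeSplit

end
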